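import Summits.QuantumFields.BalabanUV.T4Continuum.Support.VariationalVectorOneStepPhys
import Summits.QuantumFields.BalabanUV.T4Continuum.Support.VariationalVectorGaugeMove

/-!
# T⁴ programme, spine node NE2 (U1a), lane P2 — THE CURL HALF OF (ONE-min) FOR THE COMPONENTWISE CENTRED INTERPOLANT `J_c` (Minkowski shape)
# (item «V-ONE-G WITH BACKGROUND», file 4a; model level; cell `pub-balaban`)

NE2 formalisation swarm `b2b-balaban-t4-ne2-formalise-*`, leaf prover 01 GEN 8 (`prover-b2b-balaban-t4-ne2-formalise-leaf-01-g8-0`); journal INTENT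
CLAIMS.log 2026-08-20 l.18200, FINDING F-ne2leaf01g8-1 l.18526 (memo `t4/T4-EST-NE2-P2-VONEG.md` v1: V-ONE-G FAILS for V-ONE-1F's tilted `interpV` and HOLDS
for the COMPONENTWISE CENTRED interpolant — so the (ONE-min) competitor of the item is `J_c W := (x, ν) ↦ interpv T′ Rc (W(·,ν)) x`, leaf-02-g4's colour
interpolant `VariationalColourInterpolant.interpv` applied to each component, and its CURL half is needed in place of `SfV_interpV_le`).

WHAT.  With `J_c W x ν := interpv L N T′ Rc (fun z ↦ W z ν) x` (unitary one-step site frames `T′`, coarse bond operators `Rc`, fine bond operators `R′`, the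
two FRAME defects `≤ m` of V-COL-ONE):
 * §1 **`norm_cDv_interpv_sub_le`**: the EXACT leading term of the fine covariant derivative of the colour interpolant —
   `‖D′_μ(interpv λ)(x) − T′(x)⋆((1∕L)•(D_μλ)(y) + err₂(y,j,μ))‖ ≤ m·‖Φ(x + e_μ)‖` at `x = bpt y j` (leaf-02-g4's `norm_cDv_interpv_le` kept as an identity up
   to the frame defect: `cov_diff_split_frame` + `Phiv_succ_sub` ∕ `Rc_Phiv_sub`);
 * §2 **`norm_curlV_centred_le`** (pointwise): `‖curl′(J_cW)(x,μ,ν)‖ ≤ (1∕L)‖curl_{Rc}W(y,μ,ν)‖ + ‖err₂(W_ν)(y,j,μ)‖ + ‖err₂(W_μ)(y,j,ν)‖ + m(‖Φ_ν(x+e_μ)‖ + ‖Φ_μ(x+e_ν)‖)`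
   and **`curlSq_centred_le`** (lattice units, Minkowski over `sum3_sq_le`, `sum_norm_err2v_sq_le`, `sum_norm_sq_PhiFv_le`):
   `curlSq′(J_cW) ≤ (√(L^{d−2}·curlSq_{Rc} W) + √(2d·L^{d−1}·hessV W + 16d(1+d²)m²·L^d·nsqV W))²`;
 * §3 **`SfV_centred_le`** (physical units): `SfV n L M R′ 0 (J_cW) ≤ (√(ScV n M Rc 0 W) + √((dL∕n²)·ρ_V W) + √(8d(1+d²))·(nLm)·√(qWV W))²` and the (C)₀ shape of
   file 1's `hONEm_of_curl_oneG(_repair)` **`SfV_centred_le_socket`**: `≤ (√(ScV n M Rc 0 W + ε·(ScV n M Rc 0 W + ρ_V W)) + √(8d(1+d²))·(nLm)·√(qWV W))²` with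
   `ε = s + (1 + s⁻¹)·dL∕n²` for any `s > 0` (the centred weights lose the tilt's exact «face sums = D(curl)» identity of V-ONE-1F, so a first-order cross term
   remains; with `s = √(dL)∕n` the rate is `L^{−k}·√(dL)(1 + o(1))`, still geometric).

HONEST FRAMING (T4-DAG p. 1).  Lattice bookkeeping at MODEL level (frames ∕ bond operators DATA, c5); [folklore]; nothing printed is a hypothesis; no `def`,
no `def … : Prop`, no `sorry`; axioms standard.  This is the curl half only; DIV-INTERP and the composite-fibre defect of `J_c` remain OPEN; (ONE-min) ∕ V-END
with background ∕ NE2 NOT proved; NE3 OPEN; spine PROVED 0∕9 unchanged; rung (B)+1 on a fixed finite T⁴ — NOT infinite volume, NOT mass gap, NOT Clay.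
HONEST DEPENDENCY (cell, verbatim): continuum YM on T⁴ ⇐ BetaPertH ∧ nine spine estimates (0/9 proved); BetaPertH ⇐ (D1) ∧ (D4) ∧ CAP+tail; G-an2-4 gates
asym, D1 and NE2/3/4.
-/

noncomputable section

namespace Summit.QuantumFields.BalabanUV.T4Continuum.VariationalVectorCentredCurl

open Finset
open scoped InnerProductSpace
open Literature.MathematicalPhysics.QuantumFieldTheory.Balaban1983to89
open Literature.MathematicalPhysics.QuantumFieldTheory.Balaban1983to89.B5Prop11Plancherel (Tor fine unitVec)
open Literature.MathematicalPhysics.QuantumFieldTheory.Balaban1983to89.B5Block118 (bpt)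
open Literature.MathematicalPhysics.QuantumFieldTheory.Balaban1983to89.B5Blocks16 (blockOf blockOf_bpt bpt_bijective)
open Literature.MathematicalPhysics.QuantumFieldTheory.Balaban1983to89.B5AverageCurlStokes (sum_blocks_real sum_translate)
open Summit.QuantumFields.BalabanUV.T4Continuum.ScalarBlockTrialFunction (digits digits_bpt bpt_add_unitVec_of_lt bpt_add_unitVec_of_eq)
open Summit.QuantumFields.BalabanUV.T4Continuum.VariationalColourFederbush (cDv dirUv dirUv_nonneg norm_le_one_of_mem_unitary)
open Summit.QuantumFields.BalabanUV.T4Continuum.VariationalCovariantWeights (wt)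
open Summit.QuantumFields.BalabanUV.T4Continuum.VariationalColourInterpolant
  (Phiv PhiFv interpv hessv err2v PhiFv_bpt Phiv_succ_sub Rc_Phiv_sub cov_diff_split_frame norm_star_apply_le norm_err2v_le sum_norm_sq_PhiFv_le)
open Summit.QuantumFields.BalabanUV.T4Continuum.VariationalColourOneStep (sum_norm_err2v_sq_le)
open Summit.QuantumFields.BalabanUV.T4Continuum.VectorBlockTrialForm (nsqV nsqV_nonneg)
open Summit.QuantumFields.BalabanUV.T4Continuum.VariationalVectorForm (cdV curlV curlSq ScV SfV qWV curlSq_nonneg)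
open Summit.QuantumFields.BalabanUV.T4Continuum.VariationalVectorOneStep (hessV)
open Summit.QuantumFields.BalabanUV.T4Continuum.VariationalVectorOneStepPhys (rhoV rhoV_nonneg)
open Summit.QuantumFields.BalabanUV.T4Continuum.VariationalVectorGaugeMove (sum3_sq_le)

variable {d : ℕ} {E : Type*} [NormedAddCommGroup E] [InnerProductSpace ℂ E] [CompleteSpace E]

/-! ## §1 The fine covariant derivative of the colour interpolant: exact leading term up to the frame defect -/

section Deriv

variable (L : ℕ) [NeZero L] (N : Fin d → ℕ) [∀ μ, NeZero (N μ)] (Rc : Tor N → Fin d → (E →L[ℂ] E)) (lam : Tor N → E)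

/-- **THE FINE COVARIANT DERIVATIVE OF THE INTERPOLANT, LEADING TERM EXACT** (`x = bpt y j`, direction `μ`; unitary one-step site operators; in-block frame
defect `‖R′(x,μ)T′(x+e_μ)⋆ − T′(x)⋆‖ ≤ m`, crossing `‖R′(x,μ)T′(x+e_μ)⋆ − T′(x)⋆Rc(y,μ)‖ ≤ m`):
`‖(D′_μ Λ′)(x) − T′(x)⋆((1∕L)•(D_μλ)(y) + err₂(y,j,μ))‖ ≤ m·‖Φ(x+e_μ)‖`. [folklore] -/
theorem norm_cDv_interpv_sub_le {T' : Tor (fine L N) → (E →L[ℂ] E)} {R' : Tor (fine L N) → Fin d → (E →L[ℂ] E)} {m : ℝ}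
    (hin : ∀ (y : Tor N) (j : Fin d → Fin L) (μ : Fin d), (j μ : ℕ) + 1 < L →
      ‖R' (bpt L N y j) μ * star (T' (bpt L N y j + unitVec (fine L N) μ)) - star (T' (bpt L N y j))‖ ≤ m)
    (hcross : ∀ (y : Tor N) (j : Fin d → Fin L) (μ : Fin d), (j μ : ℕ) + 1 = L →
      ‖R' (bpt L N y j) μ * star (T' (bpt L N y j + unitVec (fine L N) μ)) - star (T' (bpt L N y j)) * Rc y μ‖ ≤ m)
    (y : Tor N) (j : Fin d → Fin L) (μ : Fin d) :
    ‖cDv (fine L N) R' (interpv L N T' Rc lam) (bpt L N y j) μ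
        - star (T' (bpt L N y j)) (((L : ℂ))⁻¹ • cDv N Rc lam y μ + err2v L N Rc lam y j μ)‖
      ≤ m * ‖PhiFv L N Rc lam (bpt L N y j + unitVec (fine L N) μ)‖ := by
  set x := bpt L N y j with hx
  set x' := bpt L N y j + unitVec (fine L N) μ with hx'
  have hcD : cDv (fine L N) R' (interpv L N T' Rc lam) x μ = R' x μ (star (T' x') (PhiFv L N Rc lam x')) - star (T' x) (PhiFv L N Rc lam x) :=
    rfl
  by_cases hlt : (j μ : ℕ) + 1 < L
  · have hne : ¬ ((j μ : ℕ) + 1 = L) := by omega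
    have hgx : PhiFv L N Rc lam x = Phiv L N Rc lam y j := PhiFv_bpt L N Rc lam y j
    have hgx' : PhiFv L N Rc lam x' = Phiv L N Rc lam y (Function.update j μ ⟨(j μ : ℕ) + 1, hlt⟩) := by
      rw [hx', bpt_add_unitVec_of_lt L N y j μ hlt, PhiFv_bpt]
    have hincr : (1 : E →L[ℂ] E) (PhiFv L N Rc lam x') - PhiFv L N Rc lam x = ((L : ℂ))⁻¹ • cDv N Rc lam y μ + err2v L N Rc lam y j μ := by
      rw [one_apply_eq_self, hgx, hgx', Phiv_succ_sub L N Rc lam y j μ hlt, err2v, if_neg hne, add_zero]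
    rw [hcD, cov_diff_split_frame (R' x μ) 1 (star (T' x)) (star (T' x')), mul_one, hincr, add_sub_cancel_left]
    exact (ContinuousLinearMap.le_opNorm _ _).trans (mul_le_mul_of_nonneg_right (hin y j μ hlt) (norm_nonneg _))
  · have heq : (j μ : ℕ) + 1 = L := by have := (j μ).is_lt; omega
    have hgx : PhiFv L N Rc lam x = Phiv L N Rc lam y j := PhiFv_bpt L N Rc lam y j
    have hgx' : PhiFv L N Rc lam x' = Phiv L N Rc lam (y + unitVec N μ) (Function.update j μ 0) := by
      rw [hx', bpt_add_unitVec_of_eq L N y j μ heq, PhiFv_bpt]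
    have hincr : Rc y μ (PhiFv L N Rc lam x') - PhiFv L N Rc lam x = ((L : ℂ))⁻¹ • cDv N Rc lam y μ + err2v L N Rc lam y j μ := by
      rw [hgx, hgx', Rc_Phiv_sub L N Rc lam y j μ heq, err2v, if_pos heq]
    rw [hcD, cov_diff_split_frame (R' x μ) (Rc y μ) (star (T' x)) (star (T' x')), hincr, add_sub_cancel_left]
    exact (ContinuousLinearMap.le_opNorm _ _).trans (mul_le_mul_of_nonneg_right (hcross y j μ heq) (norm_nonneg _))

end Deriv

/-! ## §2 The curl of the componentwise centred interpolant -/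

section Curl

variable (L : ℕ) [NeZero L] (N : Fin d → ℕ) [∀ μ, NeZero (N μ)] (Rc : Tor N → Fin d → (E →L[ℂ] E)) (W : Tor N → Fin d → E)

/-- the fine covariant difference of the componentwise interpolant is the colour interpolant's derivative of the component (definitional). [folklore] -/
theorem cdV_centred_eq (T' : Tor (fine L N) → (E →L[ℂ] E)) (R' : Tor (fine L N) → Fin d → (E →L[ℂ] E)) (x : Tor (fine L N)) (μ ν : Fin d) :
    cdV (fine L N) R' (fun x' ν' => interpv L N T' Rc (fun z => W z ν') x') x μ ν = cDv (fine L N) R' (interpv L N T' Rc (fun z => W z ν)) x μ := rfl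

/-- **POINTWISE**: `‖curl′(J_cW)(x,μ,ν)‖ ≤ (1∕L)‖curl_{Rc} W(y,μ,ν)‖ + ‖err₂(W_ν)(y,j,μ)‖ + ‖err₂(W_μ)(y,j,ν)‖ + m(‖Φ_ν(x+e_μ)‖ + ‖Φ_μ(x+e_ν)‖)`. [folklore] -/
theorem norm_curlV_centred_le {T' : Tor (fine L N) → (E →L[ℂ] E)} (hT1 : ∀ x, T' x ∈ unitary (E →L[ℂ] E))
    {R' : Tor (fine L N) → Fin d → (E →L[ℂ] E)} {m : ℝ}
    (hin : ∀ (y : Tor N) (j : Fin d → Fin L) (μ : Fin d), (j μ : ℕ) + 1 < L →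
      ‖R' (bpt L N y j) μ * star (T' (bpt L N y j + unitVec (fine L N) μ)) - star (T' (bpt L N y j))‖ ≤ m)
    (hcross : ∀ (y : Tor N) (j : Fin d → Fin L) (μ : Fin d), (j μ : ℕ) + 1 = L →
      ‖R' (bpt L N y j) μ * star (T' (bpt L N y j + unitVec (fine L N) μ)) - star (T' (bpt L N y j)) * Rc y μ‖ ≤ m)
    (y : Tor N) (j : Fin d → Fin L) (μ ν : Fin d) :
    ‖curlV (fine L N) R' (fun x' ν' => interpv L N T' Rc (fun z => W z ν') x') (bpt L N y j) μ ν‖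
      ≤ ((L : ℝ))⁻¹ * ‖curlV N Rc W y μ ν‖
        + (‖err2v L N Rc (fun z => W z ν) y j μ‖ + ‖err2v L N Rc (fun z => W z μ) y j ν‖
          + m * (‖PhiFv L N Rc (fun z => W z ν) (bpt L N y j + unitVec (fine L N) μ)‖
            + ‖PhiFv L N Rc (fun z => W z μ) (bpt L N y j + unitVec (fine L N) ν)‖)) := by
  set x := bpt L N y j with hx
  -- the two components' derivatives, with their exact leading terms
  set Aν := cDv (fine L N) R' (interpv L N T' Rc (fun z => W z ν)) x μ
  set Aμ := cDv (fine L N) R' (interpv L N T' Rc (fun z => W z μ)) x ν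
  set Bν := star (T' x) (((L : ℂ))⁻¹ • cDv N Rc (fun z => W z ν) y μ + err2v L N Rc (fun z => W z ν) y j μ)
  set Bμ := star (T' x) (((L : ℂ))⁻¹ • cDv N Rc (fun z => W z μ) y ν + err2v L N Rc (fun z => W z μ) y j ν)
  have hν := norm_cDv_interpv_sub_le L N Rc (fun z => W z ν) hin hcross y j μ
  have hμ := norm_cDv_interpv_sub_le L N Rc (fun z => W z μ) hin hcross y j ν
  have hcurl : curlV (fine L N) R' (fun x' ν' => interpv L N T' Rc (fun z => W z ν') x') x μ ν = Aν - Aμ := rfl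
  -- the leading terms combine to `T′(x)⋆((1∕L)•curl W(y,μ,ν) + err₂ν − err₂μ)`
  have hB : Bν - Bμ = star (T' x) (((L : ℂ))⁻¹ • curlV N Rc W y μ ν
      + (err2v L N Rc (fun z => W z ν) y j μ - err2v L N Rc (fun z => W z μ) y j ν)) := by
    simp only [Bν, Bμ, ← map_sub, curlV, cdV, cDv, smul_sub]
    congr 1
    abel
  have hlead : ‖Bν - Bμ‖ ≤ ((L : ℝ))⁻¹ * ‖curlV N Rc W y μ ν‖
      + (‖err2v L N Rc (fun z => W z ν) y j μ‖ + ‖err2v L N Rc (fun z => W z μ) y j ν‖) := by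
    rw [hB]
    refine (norm_star_apply_le (hT1 x) _).trans ((norm_add_le _ _).trans (add_le_add ?_ (norm_sub_le _ _)))
    rw [norm_smul, norm_inv, Complex.norm_natCast]
  calc ‖curlV (fine L N) R' (fun x' ν' => interpv L N T' Rc (fun z => W z ν') x') x μ ν‖
      = ‖(Bν - Bμ) + ((Aν - Bν) - (Aμ - Bμ))‖ := by rw [hcurl]; congr 1; abel
    _ ≤ ‖Bν - Bμ‖ + (‖Aν - Bν‖ + ‖Aμ - Bμ‖) := (norm_add_le _ _).trans (add_le_add le_rfl (norm_sub_le _ _))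
    _ ≤ _ := by nlinarith [hlead, hν, hμ]

/-- **THE CURL FORM OF THE COMPONENTWISE CENTRED INTERPOLANT (lattice units, Minkowski shape)**: unitary `T′`, contractive coarse `Rc`, frame defects `≤ m`:
`curlSq′(J_cW) ≤ (√(L^{d−2}·curlSq_{Rc} W) + √(2d·L^{d−1}·hessV W + 16d(1+d²)m²·L^d·nsqV W))²`. [folklore] -/
theorem curlSq_centred_le {T' : Tor (fine L N) → (E →L[ℂ] E)} (hT1 : ∀ x, T' x ∈ unitary (E →L[ℂ] E)) (hRc : ∀ y μ, ‖Rc y μ‖ ≤ 1)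
    {R' : Tor (fine L N) → Fin d → (E →L[ℂ] E)} {m : ℝ}
    (hin : ∀ (y : Tor N) (j : Fin d → Fin L) (μ : Fin d), (j μ : ℕ) + 1 < L →
      ‖R' (bpt L N y j) μ * star (T' (bpt L N y j + unitVec (fine L N) μ)) - star (T' (bpt L N y j))‖ ≤ m)
    (hcross : ∀ (y : Tor N) (j : Fin d → Fin L) (μ : Fin d), (j μ : ℕ) + 1 = L →
      ‖R' (bpt L N y j) μ * star (T' (bpt L N y j + unitVec (fine L N) μ)) - star (T' (bpt L N y j)) * Rc y μ‖ ≤ m) :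
    curlSq (fine L N) R' (fun x' ν' => interpv L N T' Rc (fun z => W z ν') x')
      ≤ (Real.sqrt ((L : ℝ) ^ d / (L : ℝ) ^ 2 * curlSq N Rc W)
          + Real.sqrt (2 * d * (L : ℝ) ^ (d - 1) * hessV N Rc W + 16 * d * (1 + (d : ℝ) ^ 2) * m ^ 2 * ((L : ℝ) ^ d * nsqV N W))) ^ 2 := by
  have hL : (0 : ℝ) < L := by exact_mod_cast Nat.pos_of_ne_zero (NeZero.ne L)
  have hcardR : (Fintype.card (Fin d → Fin L) : ℝ) = (L : ℝ) ^ d := by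
    rw [Fintype.card_fun, Fintype.card_fin, Fintype.card_fin]; push_cast; ring
  -- abbreviations for the error pieces at `x = bpt y j`
  set a : Tor (fine L N) → Fin d → Fin d → ℝ := fun x μ ν => ((L : ℝ))⁻¹ * ‖curlV N Rc W (blockOf L N x) μ ν‖ with ha
  set b : Tor (fine L N) → Fin d → Fin d → ℝ := fun x μ ν =>
    ‖err2v L N Rc (fun z => W z ν) (blockOf L N x) (digits L N x) μ‖ + ‖err2v L N Rc (fun z => W z μ) (blockOf L N x) (digits L N x) ν‖
      + m * (‖PhiFv L N Rc (fun z => W z ν) (x + unitVec (fine L N) μ)‖ + ‖PhiFv L N Rc (fun z => W z μ) (x + unitVec (fine L N) ν)‖) with hb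
  -- pointwise, via block coordinates
  have hpt : ∀ x μ ν, ‖curlV (fine L N) R' (fun x' ν' => interpv L N T' Rc (fun z => W z ν') x') x μ ν‖ ^ 2 ≤ (a x μ ν + b x μ ν) ^ 2 := by
    intro x μ ν
    obtain ⟨⟨y, j⟩, hx⟩ := (B5Blocks16.bpt_bijective L N).2 x
    subst hx
    have h := norm_curlV_centred_le L N Rc W hT1 hin hcross y j μ ν
    simp only [ha, hb, blockOf_bpt, digits_bpt]
    exact pow_le_pow_left₀ (norm_nonneg _) h 2
  have hmink := sum3_sq_le (fine L N) (fun x μ ν => ‖curlV (fine L N) R' (fun x' ν' => interpv L N T' Rc (fun z => W z ν') x') x μ ν‖) a b hpt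
  -- the main term: `Σ_x Σ_{μν} a² = L^d∕L²·curlSq W`
  have hA : ∑ x, ∑ μ, ∑ ν, a x μ ν ^ 2 = (L : ℝ) ^ d / (L : ℝ) ^ 2 * curlSq N Rc W := by
    have hx : ∀ x, ∑ μ, ∑ ν, a x μ ν ^ 2 = ((L : ℝ) ^ 2)⁻¹ * ∑ μ, ∑ ν, ‖curlV N Rc W (blockOf L N x) μ ν‖ ^ 2 := by
      intro x
      simp only [ha, mul_pow, inv_pow, Finset.mul_sum]
    rw [Finset.sum_congr rfl fun x _ => hx x, sum_blocks_real L N (fun x => ((L : ℝ) ^ 2)⁻¹ * ∑ μ, ∑ ν, ‖curlV N Rc W (blockOf L N x) μ ν‖ ^ 2)]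
    simp only [blockOf_bpt, Finset.sum_const, Finset.card_univ, nsmul_eq_mul, hcardR]
    unfold curlSq
    rw [Finset.mul_sum]
    refine Finset.sum_congr rfl fun y _ => ?_
    rw [div_eq_mul_inv]
    ring
  -- the error term
  have hB : ∑ x, ∑ μ, ∑ ν, b x μ ν ^ 2
      ≤ 2 * d * (L : ℝ) ^ (d - 1) * hessV N Rc W + 16 * d * (1 + (d : ℝ) ^ 2) * m ^ 2 * ((L : ℝ) ^ d * nsqV N W) := by
    -- `(b₁ + b₂ + m(c₁ + c₂))² ≤ 4(b₁² + b₂² + m²c₁² + m²c₂²)`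
    have h4 : ∀ x μ ν, b x μ ν ^ 2 ≤ 4 * (‖err2v L N Rc (fun z => W z ν) (blockOf L N x) (digits L N x) μ‖ ^ 2
        + ‖err2v L N Rc (fun z => W z μ) (blockOf L N x) (digits L N x) ν‖ ^ 2
        + m ^ 2 * ‖PhiFv L N Rc (fun z => W z ν) (x + unitVec (fine L N) μ)‖ ^ 2
        + m ^ 2 * ‖PhiFv L N Rc (fun z => W z μ) (x + unitVec (fine L N) ν)‖ ^ 2) := by
      intro x μ ν
      simp only [hb]
      nlinarith [sq_nonneg (‖err2v L N Rc (fun z => W z ν) (blockOf L N x) (digits L N x) μ‖ - ‖err2v L N Rc (fun z => W z μ) (blockOf L N x) (digits L N x) ν‖),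
        sq_nonneg (‖err2v L N Rc (fun z => W z ν) (blockOf L N x) (digits L N x) μ‖ - m * ‖PhiFv L N Rc (fun z => W z ν) (x + unitVec (fine L N) μ)‖),
        sq_nonneg (‖err2v L N Rc (fun z => W z ν) (blockOf L N x) (digits L N x) μ‖ - m * ‖PhiFv L N Rc (fun z => W z μ) (x + unitVec (fine L N) ν)‖),
        sq_nonneg (‖err2v L N Rc (fun z => W z μ) (blockOf L N x) (digits L N x) ν‖ - m * ‖PhiFv L N Rc (fun z => W z ν) (x + unitVec (fine L N) μ)‖),
        sq_nonneg (‖err2v L N Rc (fun z => W z μ) (blockOf L N x) (digits L N x) ν‖ - m * ‖PhiFv L N Rc (fun z => W z μ) (x + unitVec (fine L N) ν)‖),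
        sq_nonneg (m * ‖PhiFv L N Rc (fun z => W z ν) (x + unitVec (fine L N) μ)‖ - m * ‖PhiFv L N Rc (fun z => W z μ) (x + unitVec (fine L N) ν)‖)]
    -- sum of the `err₂` squares: `≤ L^{d−1}(d∕4)·hessV` each
    have hE1 : ∑ x, ∑ μ, ∑ ν, ‖err2v L N Rc (fun z => W z ν) (blockOf L N x) (digits L N x) μ‖ ^ 2 ≤ (L : ℝ) ^ (d - 1) * ((d : ℝ) / 4 * hessV N Rc W) := by
      rw [sum_blocks_real L N (fun x => ∑ μ, ∑ ν, ‖err2v L N Rc (fun z => W z ν) (blockOf L N x) (digits L N x) μ‖ ^ 2)]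
      simp only [blockOf_bpt, digits_bpt]
      -- reorder: Σ_y Σ_j Σ_μ Σ_ν = Σ_ν Σ_μ Σ_y Σ_j
      calc ∑ y : Tor N, ∑ j : Fin d → Fin L, ∑ μ, ∑ ν, ‖err2v L N Rc (fun z => W z ν) y j μ‖ ^ 2
          = ∑ y : Tor N, ∑ μ, ∑ ν, ∑ j : Fin d → Fin L, ‖err2v L N Rc (fun z => W z ν) y j μ‖ ^ 2 := by
            refine Finset.sum_congr rfl fun y _ => ?_
            rw [Finset.sum_comm]
            exact Finset.sum_congr rfl fun μ _ => Finset.sum_comm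
        _ ≤ ∑ y : Tor N, ∑ μ, ∑ ν : Fin d, (L : ℝ) ^ (d - 1) * ((d : ℝ) / 4 * ∑ κ, ‖cDv N Rc (fun z => cDv N Rc (fun z => W z ν) z κ) y μ‖ ^ 2) :=
            Finset.sum_le_sum fun y _ => Finset.sum_le_sum fun μ _ => Finset.sum_le_sum fun ν _ => sum_norm_err2v_sq_le L N Rc (fun z => W z ν) y μ
        _ = (L : ℝ) ^ (d - 1) * ((d : ℝ) / 4 * hessV N Rc W) := by
            have hre : ∑ y : Tor N, ∑ μ : Fin d, ∑ ν : Fin d, ∑ κ : Fin d, ‖cDv N Rc (fun z => cDv N Rc (fun z => W z ν) z κ) y μ‖ ^ 2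
                = ∑ ν : Fin d, ∑ μ : Fin d, ∑ κ : Fin d, ∑ y : Tor N, ‖cDv N Rc (fun z => cDv N Rc (fun z => W z ν) z κ) y μ‖ ^ 2 := by
              rw [Finset.sum_comm]
              have h1 : ∀ μ : Fin d, ∑ y : Tor N, ∑ ν : Fin d, ∑ κ : Fin d, ‖cDv N Rc (fun z => cDv N Rc (fun z => W z ν) z κ) y μ‖ ^ 2
                  = ∑ ν : Fin d, ∑ κ : Fin d, ∑ y : Tor N, ‖cDv N Rc (fun z => cDv N Rc (fun z => W z ν) z κ) y μ‖ ^ 2 := fun μ => by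
                rw [Finset.sum_comm]
                exact Finset.sum_congr rfl fun ν _ => Finset.sum_comm
              rw [Finset.sum_congr rfl fun μ _ => h1 μ, Finset.sum_comm]
            have hH : hessV N Rc W = ∑ ν : Fin d, ∑ μ : Fin d, ∑ κ : Fin d, ∑ y : Tor N, ‖cDv N Rc (fun z => cDv N Rc (fun z => W z ν) z κ) y μ‖ ^ 2 := by
              unfold hessV hessv dirUv; rfl
            rw [hH, ← hre]
            simp only [← Finset.mul_sum]
    have hE2 : ∑ x, ∑ μ, ∑ ν, ‖err2v L N Rc (fun z => W z μ) (blockOf L N x) (digits L N x) ν‖ ^ 2 ≤ (L : ℝ) ^ (d - 1) * ((d : ℝ) / 4 * hessV N Rc W) := by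
      have hswap : ∑ x, ∑ μ, ∑ ν, ‖err2v L N Rc (fun z => W z μ) (blockOf L N x) (digits L N x) ν‖ ^ 2
          = ∑ x, ∑ μ, ∑ ν, ‖err2v L N Rc (fun z => W z ν) (blockOf L N x) (digits L N x) μ‖ ^ 2 :=
        Finset.sum_congr rfl fun x _ => Finset.sum_comm
      rw [hswap]; exact hE1
    -- sum of the `Φ` squares: translation + `sum_norm_sq_PhiFv_le`
    have hP1 : ∑ x, ∑ μ, ∑ ν : Fin d, ‖PhiFv L N Rc (fun z => W z ν) (x + unitVec (fine L N) μ)‖ ^ 2 ≤ d * (2 * (1 + (d : ℝ) ^ 2) * ((L : ℝ) ^ d * nsqV N W)) := by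
      calc ∑ x, ∑ μ, ∑ ν : Fin d, ‖PhiFv L N Rc (fun z => W z ν) (x + unitVec (fine L N) μ)‖ ^ 2
          = ∑ μ : Fin d, ∑ ν : Fin d, ∑ x, ‖PhiFv L N Rc (fun z => W z ν) (x + unitVec (fine L N) μ)‖ ^ 2 := by
            rw [Finset.sum_comm]; exact Finset.sum_congr rfl fun μ _ => Finset.sum_comm
        _ = ∑ _μ : Fin d, ∑ ν : Fin d, ∑ x, ‖PhiFv L N Rc (fun z => W z ν) x‖ ^ 2 := by
            refine Finset.sum_congr rfl fun μ _ => Finset.sum_congr rfl fun ν _ => ?_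
            exact Fintype.sum_equiv (Equiv.addRight (unitVec (fine L N) μ)) _ _ fun x => rfl
        _ ≤ ∑ _μ : Fin d, ∑ ν : Fin d, 2 * (1 + (d : ℝ) ^ 2) * ((L : ℝ) ^ d * ∑ y, ‖W y ν‖ ^ 2) :=
            Finset.sum_le_sum fun μ _ => Finset.sum_le_sum fun ν _ => sum_norm_sq_PhiFv_le L N Rc (fun z => W z ν) hRc
        _ = d * (2 * (1 + (d : ℝ) ^ 2) * ((L : ℝ) ^ d * nsqV N W)) := by
            rw [Finset.sum_const, Finset.card_univ, Fintype.card_fin, nsmul_eq_mul]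
            congr 1
            unfold nsqV
            rw [← Finset.mul_sum, ← Finset.mul_sum, Finset.sum_comm]
    have hP2 : ∑ x, ∑ μ, ∑ ν : Fin d, ‖PhiFv L N Rc (fun z => W z μ) (x + unitVec (fine L N) ν)‖ ^ 2 ≤ d * (2 * (1 + (d : ℝ) ^ 2) * ((L : ℝ) ^ d * nsqV N W)) := by
      have hswap : ∑ x, ∑ μ, ∑ ν : Fin d, ‖PhiFv L N Rc (fun z => W z μ) (x + unitVec (fine L N) ν)‖ ^ 2
          = ∑ x, ∑ μ, ∑ ν : Fin d, ‖PhiFv L N Rc (fun z => W z ν) (x + unitVec (fine L N) μ)‖ ^ 2 :=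
        Finset.sum_congr rfl fun x _ => Finset.sum_comm
      rw [hswap]; exact hP1
    -- collect
    have hsum : ∑ x, ∑ μ, ∑ ν, b x μ ν ^ 2 ≤ 4 * (∑ x, ∑ μ, ∑ ν, ‖err2v L N Rc (fun z => W z ν) (blockOf L N x) (digits L N x) μ‖ ^ 2
        + ∑ x, ∑ μ, ∑ ν, ‖err2v L N Rc (fun z => W z μ) (blockOf L N x) (digits L N x) ν‖ ^ 2
        + m ^ 2 * ∑ x, ∑ μ, ∑ ν : Fin d, ‖PhiFv L N Rc (fun z => W z ν) (x + unitVec (fine L N) μ)‖ ^ 2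
        + m ^ 2 * ∑ x, ∑ μ, ∑ ν : Fin d, ‖PhiFv L N Rc (fun z => W z μ) (x + unitVec (fine L N) ν)‖ ^ 2) := by
      have h := Finset.sum_le_sum fun x (_ : x ∈ (Finset.univ : Finset (Tor (fine L N)))) =>
        Finset.sum_le_sum fun μ (_ : μ ∈ (Finset.univ : Finset (Fin d))) => Finset.sum_le_sum fun ν (_ : ν ∈ (Finset.univ : Finset (Fin d))) => h4 x μ ν
      refine h.trans (le_of_eq ?_)
      simp only [Finset.mul_sum, Finset.sum_add_distrib, mul_add]
    have hmP1 := mul_le_mul_of_nonneg_left hP1 (sq_nonneg m)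
    have hmP2 := mul_le_mul_of_nonneg_left hP2 (sq_nonneg m)
    nlinarith [hsum, hE1, hE2, hmP1, hmP2]
  calc curlSq (fine L N) R' (fun x' ν' => interpv L N T' Rc (fun z => W z ν') x')
      = ∑ x, ∑ μ, ∑ ν, ‖curlV (fine L N) R' (fun x' ν' => interpv L N T' Rc (fun z => W z ν') x') x μ ν‖ ^ 2 := rfl
    _ ≤ (Real.sqrt (∑ x, ∑ μ, ∑ ν, a x μ ν ^ 2) + Real.sqrt (∑ x, ∑ μ, ∑ ν, b x μ ν ^ 2)) ^ 2 := hmink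
    _ ≤ _ := by
        rw [hA]
        have h0 : 0 ≤ Real.sqrt ((L : ℝ) ^ d / (L : ℝ) ^ 2 * curlSq N Rc W) + Real.sqrt (∑ x, ∑ μ, ∑ ν, b x μ ν ^ 2) := by positivity
        exact pow_le_pow_left₀ h0 (add_le_add le_rfl (Real.sqrt_le_sqrt hB)) 2

end Curl

/-! ## §3 Physical units: the (C)₀ binder of file 1 for the componentwise centred interpolant -/

section Phys

variable (n L : ℕ) [NeZero n] [NeZero L] (M : Fin d → ℕ) [hM : ∀ μ, NeZero (M μ)]

omit hM in
/-- `c·(√A + √B)² = (√(cA) + √(cB))²` for `c ≥ 0`. [folklore] -/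
theorem mul_sq_sqrt_add_sqrt {c A B : ℝ} (hc : 0 ≤ c) : c * (Real.sqrt A + Real.sqrt B) ^ 2 = (Real.sqrt (c * A) + Real.sqrt (c * B)) ^ 2 := by
  rw [Real.sqrt_mul hc, Real.sqrt_mul hc]
  have h : Real.sqrt c ^ 2 = c := Real.sq_sqrt hc
  nlinarith [h]

/-- **THE CURL HALF OF (ONE-min) FOR `J_c`, physical units, Minkowski shape**: unitary `T′`, unitary coarse `Rc`, frame defects `≤ m`:
`SfV n L M R′ 0 (J_cW) ≤ (√(ScV n M Rc 0 W) + √((dL∕n²)·ρ_V W + 8d(1+d²)·(nLm)²·qWV W))²`. [folklore] -/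
theorem SfV_centred_le {Rc : Tor (fine n M) → Fin d → (E →L[ℂ] E)} {R' : Tor (fine L (fine n M)) → Fin d → (E →L[ℂ] E)}
    {T' : Tor (fine L (fine n M)) → (E →L[ℂ] E)} (hd : 1 ≤ d) (hT1 : ∀ x, T' x ∈ unitary (E →L[ℂ] E)) (hRc1 : ∀ y μ, Rc y μ ∈ unitary (E →L[ℂ] E)) {m : ℝ}
    (hin : ∀ (y : Tor (fine n M)) (j : Fin d → Fin L) (μ : Fin d), (j μ : ℕ) + 1 < L →
      ‖R' (bpt L (fine n M) y j) μ * star (T' (bpt L (fine n M) y j + unitVec (fine L (fine n M)) μ)) - star (T' (bpt L (fine n M) y j))‖ ≤ m)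
    (hcross : ∀ (y : Tor (fine n M)) (j : Fin d → Fin L) (μ : Fin d), (j μ : ℕ) + 1 = L →
      ‖R' (bpt L (fine n M) y j) μ * star (T' (bpt L (fine n M) y j + unitVec (fine L (fine n M)) μ))
        - star (T' (bpt L (fine n M) y j)) * Rc y μ‖ ≤ m)
    (W : Tor (fine n M) → Fin d → E) :
    SfV n L M R' (fun _ => 0) (fun x ν => interpv L (fine n M) T' Rc (fun z => W z ν) x)
      ≤ (Real.sqrt (ScV n M Rc (fun _ => 0) W)
          + Real.sqrt ((d * (L : ℝ) / (n : ℝ) ^ 2) * rhoV n M Rc W + 8 * d * (1 + (d : ℝ) ^ 2) * ((n : ℝ) * L * m) ^ 2 * qWV n M W)) ^ 2 := by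
  have hn : (0 : ℝ) < n := by exact_mod_cast Nat.pos_of_ne_zero (NeZero.ne n)
  have hL : (0 : ℝ) < L := by exact_mod_cast Nat.pos_of_ne_zero (NeZero.ne L)
  have hL1 : 1 ≤ L := Nat.one_le_iff_ne_zero.mpr (NeZero.ne L)
  set cf : ℝ := (((n : ℝ) * L) ^ d)⁻¹ * ((n : ℝ) * L) ^ 2 / 2 with hcf
  have hcf0 : 0 ≤ cf := by positivity
  have hlat := curlSq_centred_le L (fine n M) Rc W hT1 (fun y μ => norm_le_one_of_mem_unitary (hRc1 y μ)) hin hcross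
  have hS : SfV n L M R' (fun _ => 0) (fun x ν => interpv L (fine n M) T' Rc (fun z => W z ν) x)
      = cf * curlSq (fine L (fine n M)) R' (fun x ν => interpv L (fine n M) T' Rc (fun z => W z ν) x) := by
    unfold SfV; rw [hcf]; ring
  -- the two rescalings
  have hpow : (L : ℝ) ^ (d - 1) * L = (L : ℝ) ^ d := by
    rw [← pow_succ, Nat.sub_add_cancel hd]
  have e1 : cf * ((L : ℝ) ^ d / (L : ℝ) ^ 2 * curlSq (fine n M) Rc W) = ScV n M Rc (fun _ => 0) W := by
    unfold ScV; rw [hcf, mul_pow, mul_pow]; field_simp; ring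
  have e2 : cf * (2 * d * (L : ℝ) ^ (d - 1) * hessV (fine n M) Rc W + 16 * d * (1 + (d : ℝ) ^ 2) * m ^ 2 * ((L : ℝ) ^ d * nsqV (fine n M) W))
      = (d * (L : ℝ) / (n : ℝ) ^ 2) * rhoV n M Rc W + 8 * d * (1 + (d : ℝ) ^ 2) * ((n : ℝ) * L * m) ^ 2 * qWV n M W := by
    unfold rhoV qWV; rw [hcf, mul_pow, mul_pow]
    rw [← hpow]
    field_simp
    ring
  rw [hS]
  refine (mul_le_mul_of_nonneg_left hlat hcf0).trans (le_of_eq ?_)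
  rw [mul_sq_sqrt_add_sqrt hcf0, e1, e2]

/-- **THE (C)₀ BINDER OF FILE 1 FOR `J_c`** (`hONEm_of_curl_oneG(_repair)`'s `hC`): for any `s > 0`,
`SfV R′ 0 (J_cW) ≤ (√(ScV Rc 0 W + ε·ρ₁ W) + δ′·√(qWV W))²` with `ρ₁ := ScV n M Rc 0 W + ρ_V W`, `ε := s + (1 + s⁻¹)·dL∕n²`, `δ′ := √(8d(1+d²))·(nLm)` —
from `SfV_centred_le` by `√(a+b) ≤ √a + √b`, `(√A + √B)² ≤ (1+s)A + (1+s⁻¹)B`. [folklore] -/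
theorem SfV_centred_le_socket {Rc : Tor (fine n M) → Fin d → (E →L[ℂ] E)} {R' : Tor (fine L (fine n M)) → Fin d → (E →L[ℂ] E)}
    {T' : Tor (fine L (fine n M)) → (E →L[ℂ] E)} (hd : 1 ≤ d) (hT1 : ∀ x, T' x ∈ unitary (E →L[ℂ] E)) (hRc1 : ∀ y μ, Rc y μ ∈ unitary (E →L[ℂ] E))
    {m : ℝ} (hm : 0 ≤ m)
    (hin : ∀ (y : Tor (fine n M)) (j : Fin d → Fin L) (μ : Fin d), (j μ : ℕ) + 1 < L →
      ‖R' (bpt L (fine n M) y j) μ * star (T' (bpt L (fine n M) y j + unitVec (fine L (fine n M)) μ)) - star (T' (bpt L (fine n M) y j))‖ ≤ m)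
    (hcross : ∀ (y : Tor (fine n M)) (j : Fin d → Fin L) (μ : Fin d), (j μ : ℕ) + 1 = L →
      ‖R' (bpt L (fine n M) y j) μ * star (T' (bpt L (fine n M) y j + unitVec (fine L (fine n M)) μ))
        - star (T' (bpt L (fine n M) y j)) * Rc y μ‖ ≤ m)
    {s : ℝ} (hs : 0 < s) (W : Tor (fine n M) → Fin d → E) :
    SfV n L M R' (fun _ => 0) (fun x ν => interpv L (fine n M) T' Rc (fun z => W z ν) x)
      ≤ (Real.sqrt (ScV n M Rc (fun _ => 0) W + (s + (1 + s⁻¹) * (d * (L : ℝ) / (n : ℝ) ^ 2)) * (ScV n M Rc (fun _ => 0) W + rhoV n M Rc W))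
          + Real.sqrt (8 * d * (1 + (d : ℝ) ^ 2)) * ((n : ℝ) * L * m) * Real.sqrt (qWV n M W)) ^ 2 := by
  have hn : (0 : ℝ) < n := by exact_mod_cast Nat.pos_of_ne_zero (NeZero.ne n)
  have hL : (0 : ℝ) < L := by exact_mod_cast Nat.pos_of_ne_zero (NeZero.ne L)
  have h := SfV_centred_le n L M hd hT1 hRc1 hin hcross W
  set A := ScV n M Rc (fun _ => 0) W with hA
  set ρ := rhoV n M Rc W with hρ
  set q := qWV n M W with hq
  set ε₀ : ℝ := d * (L : ℝ) / (n : ℝ) ^ 2 with hε₀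
  set K : ℝ := 8 * d * (1 + (d : ℝ) ^ 2) * ((n : ℝ) * L * m) ^ 2 with hK
  have hA0 : 0 ≤ A := by rw [hA]; unfold ScV; have := curlSq_nonneg (fine n M) Rc W; positivity
  have hρ0 : 0 ≤ ρ := rhoV_nonneg n M Rc W
  have hq0 : 0 ≤ q := by rw [hq]; unfold qWV; have := nsqV_nonneg (fine n M) W; positivity
  have hε0 : 0 ≤ ε₀ := by positivity
  have hK0 : 0 ≤ K := by positivity
  -- `√(ε₀ρ + Kq) ≤ √(ε₀ρ) + √K·√q`
  have hsqrt_add : ∀ a b : ℝ, 0 ≤ a → 0 ≤ b → Real.sqrt (a + b) ≤ Real.sqrt a + Real.sqrt b := by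
    intro a b ha hb
    rw [Real.sqrt_le_left (by positivity)]
    nlinarith [Real.sq_sqrt ha, Real.sq_sqrt hb, Real.sqrt_nonneg a, Real.sqrt_nonneg b]
  have hsplit : Real.sqrt (ε₀ * ρ + K * q) ≤ Real.sqrt (ε₀ * ρ) + Real.sqrt K * Real.sqrt q := by
    rw [← Real.sqrt_mul hK0]
    exact hsqrt_add _ _ (by positivity) (by positivity)
  -- `(√A + √(ε₀ρ))² ≤ A + ε(A + ρ)` with `ε = s + (1 + s⁻¹)ε₀`
  have hparam : (Real.sqrt A + Real.sqrt (ε₀ * ρ)) ^ 2 ≤ A + (s + (1 + s⁻¹) * ε₀) * (A + ρ) := by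
    have hsa : Real.sqrt A ^ 2 = A := Real.sq_sqrt hA0
    have hsb : Real.sqrt (ε₀ * ρ) ^ 2 = ε₀ * ρ := Real.sq_sqrt (by positivity)
    -- `2√A·√(ε₀ρ) ≤ s·A + s⁻¹·ε₀ρ`
    have key : 2 * Real.sqrt A * Real.sqrt (ε₀ * ρ) ≤ s * A + s⁻¹ * (ε₀ * ρ) := by
      have h0 := sq_nonneg (s * Real.sqrt A - Real.sqrt (ε₀ * ρ))
      have e : s * (s * A + s⁻¹ * (ε₀ * ρ)) = (s * Real.sqrt A) ^ 2 + Real.sqrt (ε₀ * ρ) ^ 2 := by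
        rw [mul_pow, hsa, hsb]; field_simp
      have h2 : s * (2 * Real.sqrt A * Real.sqrt (ε₀ * ρ)) ≤ s * (s * A + s⁻¹ * (ε₀ * ρ)) := by rw [e]; nlinarith [h0]
      exact le_of_mul_le_mul_left h2 hs
    have hsinv : 0 ≤ s⁻¹ := by positivity
    nlinarith [key, hsa, hsb, mul_nonneg hs.le hρ0, mul_nonneg (mul_nonneg (by positivity : (0:ℝ) ≤ 1 + s⁻¹) hε0) hA0]
  have hroot : Real.sqrt A + Real.sqrt (ε₀ * ρ) ≤ Real.sqrt (A + (s + (1 + s⁻¹) * ε₀) * (A + ρ)) := by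
    rw [← Real.sqrt_sq (by positivity : 0 ≤ Real.sqrt A + Real.sqrt (ε₀ * ρ))]
    exact Real.sqrt_le_sqrt hparam
  have hKroot : Real.sqrt K = Real.sqrt (8 * d * (1 + (d : ℝ) ^ 2)) * ((n : ℝ) * L * m) := by
    rw [hK, Real.sqrt_mul (by positivity), Real.sqrt_sq (by positivity)]
  have h0 : 0 ≤ Real.sqrt A + Real.sqrt (ε₀ * ρ + K * q) := by positivity
  calc SfV n L M R' (fun _ => 0) (fun x ν => interpv L (fine n M) T' Rc (fun z => W z ν) x)
      ≤ (Real.sqrt A + Real.sqrt (ε₀ * ρ + K * q)) ^ 2 := h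
    _ ≤ (Real.sqrt (A + (s + (1 + s⁻¹) * ε₀) * (A + ρ)) + Real.sqrt K * Real.sqrt q) ^ 2 := by
        refine pow_le_pow_left₀ h0 ?_ 2
        linarith [hsplit, hroot]
    _ = _ := by rw [hKroot]

end Phys


end Summit.QuantumFields.BalabanUV.T4Continuum.VariationalVectorCentredCurl

end
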